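import Summits.HodgeConjecture.HodgeConjecture.Theorems.Ring2WeilCoverageWeilGramCMPoint
import Summits.HodgeConjecture.HodgeConjecture.Theorems.Ring2WeilCoverageCyclotomicUnconditional
import Summits.HodgeConjecture.HodgeConjecture.Theorems.Ring2WeilCoverageRealUnitNormHalfSystems
import Summits.HodgeConjecture.HodgeConjecture.Theorems.Ring2WeilCoverageNormTable
import Mathlib.Tactic.ComputeDegree
import HarnessLib

/-!
# Weil-type family coverage — THE COMPONENTS OF THE WEIL-TYPE `ℤ[ζ₂₈]`-SIXFOLDS, I: level lemmas and the principal-type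
# form `(E_ξ, i)`, `i = ζ⁷`: van Geemen Gram determinant `det a = −64 = −8²` in the real frame `1, θ, …, θ⁵` of
# `ℚ(ζ₂₈)⁺` — RIGHT sign for Weil signature `(3,3)`, SPLIT class (the census YES row `(28, ℚ(i))`, row R0 for `ℚ(i)`)

research route conditional on HC_CM; not a corollary; Q11.4-sentence-2 already refuted in dim ≥ 3.

Ring 2, WEIL-TYPE FAMILY-COVERAGE CENSUS (`HOME/WEIL-FAMILY-COVERAGE.md` `## b01`, block b01.41 (C) «COMPONENTS (S-pencil,
exact)» at `g = 6`; b01.47 (E) «NOT CLAIMED: the `g = 6` placements»; owner ring2-b01), part 104 of the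
`Ring2WeilCoverage*` series: the level-`28` companion of part 98 (`K = ℚ(ζ₂₈)`, `g = 6`, `n = 3`, `ξ = ζ⁵/Φ₂₈′(ζ)`,
frame `xᵢ = θ^i`, `θ = ζ + ζ⁻¹`, `i < 6`; independent of part 98).

* §0 level lemmas: `Φ₂₈(ζ) = ζ¹² − ζ¹⁰ + ζ⁸ − ζ⁶ + ζ⁴ − ζ² + 1 = 0`, `θζ = ζ² + 1`, `i = ζ⁷` skew with `i² = −1`, `ξ`
  skew; §0b the evaluation step (part 81).
* §1 the eleven traces `Tr(ξ i θ^m)`, `m ≤ 10`, and the Gram datum: **`a = −(Tr(ξ i θ^{i+j}))`, `det a = −64`** —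
  `(−1)³ det a > 0`, the right sign; part 105 (`…Level28Principal`): basis, invariance over the principal type, census
  form and the SPLIT class (row R0 for `ℚ(i)`); parts 106–108: `ℚ(√−7)` (NO row), type `𝔮₇`, type `(2 + √7)` → R4.

HONEST FRAMING as parts 82–103: kernel statements about traces in `ℚ(ζ₂₈)` and the rational Gram matrices of part 82;
the ROW words read the class `[det a]` by [vG94 Lemma 5.2 (3), (5.4.1)]; nothing about Hodge classes, `W_K`, general
members or HC; `HC_CM` is used nowhere.  No `def`, no named fact, no `sorry`.  Certificates from `work/py/gen6.py` +
`lev28.py` (exact arithmetic in `ℚ[x]/Φ₂₈`), re-verified by `linear_combination`.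

References: [cite: vanGeemen1994HodgeAV, Lemma 5.2 (2)–(4), 5.4 and (5.4.1)]; [cite: Shimura1998, §14.3 Prop. 4–5,
pp. 103–104]; [cite: NeukirchANT1999, Ch. III (2.4)]; census b01.41 (C) (seat-derived).
-/

noncomputable section

open Polynomial NumberField Module
open scoped nonZeroDivisors

namespace Summit.HodgeConjecture.Ring2WeilCoverage.WeilGramLevel28

open Literature.AlgebraicGeometry.VanGeemen1994 (weilField weilNormResidueGroup)
open Literature.AlgebraicGeometry.Motives (CMType normUnitsSubgroup)
open Literature.NumberTheory.ComplexMultiplication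
open Summit.HodgeConjecture.Ring2WeilCoverage.TraceGramDeterminant (trace_aeval_zeta_mul_inv)
open Summit.HodgeConjecture.Ring2WeilCoverage.WeilGramCMPoint
open Summit.HodgeConjecture.Ring2WeilCoverage.RealUnitNormHalfSystems (complexConj_eq_inv)
open Summit.HodgeConjecture.Ring2WeilCoverage.CyclotomicPrincipalObstruction (complexConj_xi)
open Summit.HodgeConjecture.Ring2WeilCoverage.CyclotomicDifferent (isOfType_one_xi_top xi_ne_zero)
open Summit.HodgeConjecture.HodgeConjecture.Ring2.WeilCoverage (mk_neg_eq_split_of_odd mk_neg_ne_split_of_odd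
  mem_normUnitsSubgroup_of_sq_add_mul_sq)
open Summit.HodgeConjecture.HodgeConjecture.Ring2.Hypotheses (splitDiscriminantClass)
variable {K : Type} [Field K] [NumberField K] {ζ : K}

/-! ### §0 Level lemmas -/

omit [NumberField K] in
/-- **`Φ₂₈(ζ) = 0` written out**: `ζ¹² − ζ¹⁰ + ζ⁸ − ζ⁶ + ζ⁴ − ζ² + 1 = 0`
(`(x¹⁴ − 1)(x² + 1)Φ₂₈(x) = x²⁸ − 1`, `ζ¹⁴ ≠ 1`, `ζ⁴ ≠ 1`). research route conditional on HC_CM; not a corollary; Q11.4-sentence-2 already refuted in dim ≥ 3. [folklore] -/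
theorem cyc_twentyEight (hζ : IsPrimitiveRoot ζ 28) :
    ζ ^ 12 - ζ ^ 10 + ζ ^ 8 - ζ ^ 6 + ζ ^ 4 - ζ ^ 2 + 1 = 0 := by
  have h28 : ζ ^ 28 = 1 := hζ.pow_eq_one
  have h14 : ζ ^ 14 - 1 ≠ 0 := sub_ne_zero.mpr (hζ.pow_ne_one_of_pos_of_lt (by norm_num) (by norm_num))
  have h4 : ζ ^ 4 ≠ 1 := hζ.pow_ne_one_of_pos_of_lt (by norm_num) (by norm_num)
  have h2 : ζ ^ 2 + 1 ≠ 0 := by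
    intro h
    apply h4
    linear_combination (ζ ^ 2 - 1) * h
  have h : (ζ ^ 14 - 1) * (ζ ^ 2 + 1) * (ζ ^ 12 - ζ ^ 10 + ζ ^ 8 - ζ ^ 6 + ζ ^ 4 - ζ ^ 2 + 1) = 0 := by
    linear_combination h28
  rcases mul_eq_zero.mp h with h' | h'
  · exact absurd h' (mul_ne_zero h14 h2)
  · exact h'

omit [NumberField K] in
/-- `θζ = ζ² + 1` for `θ = ζ + ζ⁻¹`. [folklore] -/
theorem theta_mul_zeta (hζ : IsPrimitiveRoot ζ 28) : (ζ + ζ⁻¹) * ζ = ζ ^ 2 + 1 := by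
  have hζ0 : ζ ≠ 0 := hζ.ne_zero (by norm_num)
  rw [add_mul, inv_mul_cancel₀ hζ0]
  ring

omit [NumberField K] in
/-- `(ζ⁻¹)^a = ζ^b` when `a + b = 28`. [folklore] -/
theorem inv_pow_eq_pow (hζ : IsPrimitiveRoot ζ 28) {a b : ℕ} (hab : a + b = 28) : ζ⁻¹ ^ a = ζ ^ b := by
  rw [inv_pow]
  apply inv_eq_of_mul_eq_one_right
  rw [← pow_add, hab, hζ.pow_eq_one]

/-- `θ = ζ + ζ⁻¹` is real. [folklore] -/
theorem complexConj_theta [IsCMField K] (hζ : IsPrimitiveRoot ζ 28) :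
    IsCMField.complexConj K (ζ + ζ⁻¹) = ζ + ζ⁻¹ := by
  rw [map_add, map_inv₀, complexConj_eq_inv hζ, inv_inv, add_comm]

/-- The frame `xᵢ = θ^i` is real. [folklore] -/
theorem complexConj_thetaFrame [IsCMField K] (hζ : IsPrimitiveRoot ζ 28) {m : ℕ} {x : Fin m → K}
    (hx : ∀ i, x i = (ζ + ζ⁻¹) ^ (i : ℕ)) (i : Fin m) : IsCMField.complexConj K (x i) = x i := by
  rw [hx i, map_pow, complexConj_theta hζ]

/-- `ξ = ζ⁵/Φ′(ζ)` is skew (part 7, `g − 1 = 5`). [folklore] -/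
theorem complexConj_xi_twentyEight [IsCMField K] (hζ : IsPrimitiveRoot ζ 28) :
    IsCMField.complexConj K (ζ ^ 5 * (aeval ζ (derivative (cyclotomic 28 ℚ)))⁻¹) =
      -(ζ ^ 5 * (aeval ζ (derivative (cyclotomic 28 ℚ)))⁻¹) :=
  complexConj_xi hζ (k := 5) (by decide)

omit [NumberField K] in
/-- **`(ζ⁷)² = −1`**: `s = √−1 = ζ⁷ = i` generates `K_d = ℚ(√−1) ⊂ ℚ(ζ_28)`. [folklore] -/
theorem sq_sqrtNegOne (hζ : IsPrimitiveRoot ζ 28) : (ζ ^ 7) ^ 2 = -1 := by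
  linear_combination (1 + ζ^2) * cyc_twentyEight hζ

/-- **`s = √−1 = ζ⁷ = i` is skew** (`s^ρ = −s`). [folklore] -/
theorem complexConj_sqrtNegOne [IsCMField K] (hζ : IsPrimitiveRoot ζ 28) :
    IsCMField.complexConj K (ζ ^ 7) = -(ζ ^ 7) := by
  simp only [map_pow, complexConj_eq_inv hζ]
  rw [inv_pow_eq_pow hζ (show 7 + 21 = 28 by norm_num)]
  linear_combination (ζ^7 + ζ^9) * cyc_twentyEight hζ


/-! ### §0b The evaluation step: `Tr(y·θ^m)` from a certificate `y(ζ² + 1)^m = R(ζ)Φ′(ζ)⁻¹ζ^m` (part 81) -/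

/-- `Tr_{K/ℚ}(y) = coeff₁₁(R)` if `y = R(ζ)/Φ′(ζ)` with `deg R ≤ 11` (part 81 `trace_aeval_zeta_mul_inv`). research route conditional on HC_CM; not a corollary; Q11.4-sentence-2 already refuted in dim ≥ 3. [folklore] -/
theorem trace_of_key₀ [IsCyclotomicExtension {28} ℚ K] (hζ : IsPrimitiveRoot ζ 28) {y : K} (R : ℚ[X])
    (hR : R.natDegree ≤ 11) (hkey : y = aeval ζ R * (aeval ζ (derivative (cyclotomic 28 ℚ)))⁻¹) :
    Algebra.trace ℚ K y = R.coeff 11 := by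
  have hφ : Nat.totient 28 = 12 := by decide
  rw [hkey, trace_aeval_zeta_mul_inv hζ R (by rw [hφ]; omega), hφ]

/-- `Tr_{K/ℚ}(y·θ) = coeff₁₁(R)` if `y(ζ² + 1) = R(ζ)Φ′(ζ)⁻¹·ζ` (`θζ = ζ² + 1`). research route conditional on HC_CM; not a corollary; Q11.4-sentence-2 already refuted in dim ≥ 3. [folklore] -/
theorem trace_of_key₁ [IsCyclotomicExtension {28} ℚ K] (hζ : IsPrimitiveRoot ζ 28) {y : K} (R : ℚ[X])
    (hR : R.natDegree ≤ 11) (hkey : y * (ζ ^ 2 + 1) = aeval ζ R * (aeval ζ (derivative (cyclotomic 28 ℚ)))⁻¹ * ζ) :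
    Algebra.trace ℚ K (y * (ζ + ζ⁻¹)) = R.coeff 11 := by
  have hζ0 : ζ ≠ 0 := hζ.ne_zero (by norm_num)
  refine trace_of_key₀ hζ R hR (mul_right_cancel₀ hζ0 ?_)
  rw [mul_assoc, theta_mul_zeta hζ, hkey]

/-- `Tr_{K/ℚ}(y·θ^m) = coeff₁₁(R)` if `y(ζ² + 1)^m = R(ζ)Φ′(ζ)⁻¹·ζ^m` (`θ^m ζ^m = (ζ² + 1)^m`). research route conditional on HC_CM; not a corollary; Q11.4-sentence-2 already refuted in dim ≥ 3. [folklore] -/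
theorem trace_of_key [IsCyclotomicExtension {28} ℚ K] (hζ : IsPrimitiveRoot ζ 28) {y : K} {m : ℕ} (R : ℚ[X])
    (hR : R.natDegree ≤ 11) (hkey : y * (ζ ^ 2 + 1) ^ m = aeval ζ R * (aeval ζ (derivative (cyclotomic 28 ℚ)))⁻¹ * ζ ^ m) :
    Algebra.trace ℚ K (y * (ζ + ζ⁻¹) ^ m) = R.coeff 11 := by
  have hζ0 : ζ ≠ 0 := hζ.ne_zero (by norm_num)
  refine trace_of_key₀ hζ R hR (mul_right_cancel₀ (pow_ne_zero m hζ0) ?_)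
  rw [mul_assoc, ← mul_pow, theta_mul_zeta hζ, hkey]

/-! ### §1 The principal-type form `(E_ξ, i)`: eleven traces, the `6 × 6` Hankel matrix, `det a = −64` -/

/-- `Tr(ζ′sθ^0) = 0` for `ζ′ = ξ = ζ⁵/Φ₂₈′(ζ)`, `s = √−1 = ζ⁷ = i`, `θ = ζ + ζ⁻¹` (Euler evaluation). research route conditional on HC_CM; not a corollary; Q11.4-sentence-2 already refuted in dim ≥ 3. [folklore] -/
theorem trace_xi_sqrtNegOne_zero [IsCyclotomicExtension {28} ℚ K] (hζ : IsPrimitiveRoot ζ 28) :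
    Algebra.trace ℚ K ((ζ ^ 5 * (aeval ζ (derivative (cyclotomic 28 ℚ)))⁻¹) * (ζ ^ 7)) = 0 := by
  have hΦ := cyc_twentyEight hζ
  rw [trace_of_key₀ hζ (C (-1 : ℚ) + C (0 : ℚ) * X + C (1 : ℚ) * X ^ 2 + C (0 : ℚ) * X ^ 3 + C (-1 : ℚ) * X ^ 4 +
      C (0 : ℚ) * X ^ 5 + C (1 : ℚ) * X ^ 6 + C (0 : ℚ) * X ^ 7 + C (-1 : ℚ) * X ^ 8 + C (0 : ℚ) * X ^ 9 +
      C (1 : ℚ) * X ^ 10 + C (0 : ℚ) * X ^ 11) (by compute_degree) (by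
    simp only [map_add, map_mul, map_pow, aeval_C, aeval_X, eq_ratCast]
    push_cast
    linear_combination ((aeval ζ (derivative (cyclotomic 28 ℚ)))⁻¹ * (1)) * hΦ)]
  norm_num [coeff_X_pow, coeff_X, coeff_C, coeff_one]

/-- `Tr(ζ′sθ^1) = 2` for `ζ′ = ξ = ζ⁵/Φ₂₈′(ζ)`, `s = √−1 = ζ⁷ = i`, `θ = ζ + ζ⁻¹` (Euler evaluation). research route conditional on HC_CM; not a corollary; Q11.4-sentence-2 already refuted in dim ≥ 3. [folklore] -/
theorem trace_xi_sqrtNegOne_one [IsCyclotomicExtension {28} ℚ K] (hζ : IsPrimitiveRoot ζ 28) :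
    Algebra.trace ℚ K ((ζ ^ 5 * (aeval ζ (derivative (cyclotomic 28 ℚ)))⁻¹) * (ζ ^ 7) * (ζ + ζ⁻¹)) = 2 := by
  have hΦ := cyc_twentyEight hζ
  rw [trace_of_key₁ hζ (C (0 : ℚ) + C (-1 : ℚ) * X + C (0 : ℚ) * X ^ 2 + C (1 : ℚ) * X ^ 3 + C (0 : ℚ) * X ^ 4 +
      C (-1 : ℚ) * X ^ 5 + C (0 : ℚ) * X ^ 6 + C (1 : ℚ) * X ^ 7 + C (0 : ℚ) * X ^ 8 + C (-1 : ℚ) * X ^ 9 +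
      C (0 : ℚ) * X ^ 10 + C (2 : ℚ) * X ^ 11) (by compute_degree) (by
    simp only [map_add, map_mul, map_pow, aeval_C, aeval_X, eq_ratCast]
    push_cast
    linear_combination ((aeval ζ (derivative (cyclotomic 28 ℚ)))⁻¹ * (ζ^2)) * hΦ)]
  norm_num [coeff_X_pow, coeff_X, coeff_C, coeff_one]

/-- `Tr(ζ′sθ^2) = 0` for `ζ′ = ξ = ζ⁵/Φ₂₈′(ζ)`, `s = √−1 = ζ⁷ = i`, `θ = ζ + ζ⁻¹` (Euler evaluation). research route conditional on HC_CM; not a corollary; Q11.4-sentence-2 already refuted in dim ≥ 3. [folklore] -/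
theorem trace_xi_sqrtNegOne_two [IsCyclotomicExtension {28} ℚ K] (hζ : IsPrimitiveRoot ζ 28) :
    Algebra.trace ℚ K ((ζ ^ 5 * (aeval ζ (derivative (cyclotomic 28 ℚ)))⁻¹) * (ζ ^ 7) * (ζ + ζ⁻¹) ^ 2) = 0 := by
  have hΦ := cyc_twentyEight hζ
  rw [trace_of_key hζ (C (-3 : ℚ) + C (0 : ℚ) * X + C (2 : ℚ) * X ^ 2 + C (0 : ℚ) * X ^ 3 + C (-2 : ℚ) * X ^ 4 +
      C (0 : ℚ) * X ^ 5 + C (2 : ℚ) * X ^ 6 + C (0 : ℚ) * X ^ 7 + C (-2 : ℚ) * X ^ 8 + C (0 : ℚ) * X ^ 9 +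
      C (3 : ℚ) * X ^ 10 + C (0 : ℚ) * X ^ 11) (by compute_degree) (by
    simp only [map_add, map_mul, map_pow, aeval_C, aeval_X, eq_ratCast]
    push_cast
    linear_combination ((aeval ζ (derivative (cyclotomic 28 ℚ)))⁻¹ * (3 * ζ^2 + ζ^4)) * hΦ)]
  norm_num [coeff_X_pow, coeff_X, coeff_C, coeff_one]

/-- `Tr(ζ′sθ^3) = 6` for `ζ′ = ξ = ζ⁵/Φ₂₈′(ζ)`, `s = √−1 = ζ⁷ = i`, `θ = ζ + ζ⁻¹` (Euler evaluation). research route conditional on HC_CM; not a corollary; Q11.4-sentence-2 already refuted in dim ≥ 3. [folklore] -/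
theorem trace_xi_sqrtNegOne_three [IsCyclotomicExtension {28} ℚ K] (hζ : IsPrimitiveRoot ζ 28) :
    Algebra.trace ℚ K ((ζ ^ 5 * (aeval ζ (derivative (cyclotomic 28 ℚ)))⁻¹) * (ζ ^ 7) * (ζ + ζ⁻¹) ^ 3) = 6 := by
  have hΦ := cyc_twentyEight hζ
  rw [trace_of_key hζ (C (0 : ℚ) + C (-4 : ℚ) * X + C (0 : ℚ) * X ^ 2 + C (3 : ℚ) * X ^ 3 + C (0 : ℚ) * X ^ 4 +
      C (-3 : ℚ) * X ^ 5 + C (0 : ℚ) * X ^ 6 + C (3 : ℚ) * X ^ 7 + C (0 : ℚ) * X ^ 8 + C (-2 : ℚ) * X ^ 9 +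
      C (0 : ℚ) * X ^ 10 + C (6 : ℚ) * X ^ 11) (by compute_degree) (by
    simp only [map_add, map_mul, map_pow, aeval_C, aeval_X, eq_ratCast]
    push_cast
    linear_combination ((aeval ζ (derivative (cyclotomic 28 ℚ)))⁻¹ * (4 * ζ^4 + ζ^6)) * hΦ)]
  norm_num [coeff_X_pow, coeff_X, coeff_C, coeff_one]

/-- `Tr(ζ′sθ^4) = 0` for `ζ′ = ξ = ζ⁵/Φ₂₈′(ζ)`, `s = √−1 = ζ⁷ = i`, `θ = ζ + ζ⁻¹` (Euler evaluation). research route conditional on HC_CM; not a corollary; Q11.4-sentence-2 already refuted in dim ≥ 3. [folklore] -/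
theorem trace_xi_sqrtNegOne_four [IsCyclotomicExtension {28} ℚ K] (hζ : IsPrimitiveRoot ζ 28) :
    Algebra.trace ℚ K ((ζ ^ 5 * (aeval ζ (derivative (cyclotomic 28 ℚ)))⁻¹) * (ζ ^ 7) * (ζ + ζ⁻¹) ^ 4) = 0 := by
  have hΦ := cyc_twentyEight hζ
  rw [trace_of_key hζ (C (-10 : ℚ) + C (0 : ℚ) * X + C (5 : ℚ) * X ^ 2 + C (0 : ℚ) * X ^ 3 + C (-6 : ℚ) * X ^ 4 +
      C (0 : ℚ) * X ^ 5 + C (6 : ℚ) * X ^ 6 + C (0 : ℚ) * X ^ 7 + C (-5 : ℚ) * X ^ 8 + C (0 : ℚ) * X ^ 9 +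
      C (10 : ℚ) * X ^ 10 + C (0 : ℚ) * X ^ 11) (by compute_degree) (by
    simp only [map_add, map_mul, map_pow, aeval_C, aeval_X, eq_ratCast]
    push_cast
    linear_combination ((aeval ζ (derivative (cyclotomic 28 ℚ)))⁻¹ * (10 * ζ^4 + 5 * ζ^6 + ζ^8)) * hΦ)]
  norm_num [coeff_X_pow, coeff_X, coeff_C, coeff_one]

/-- `Tr(ζ′sθ^5) = 20` for `ζ′ = ξ = ζ⁵/Φ₂₈′(ζ)`, `s = √−1 = ζ⁷ = i`, `θ = ζ + ζ⁻¹` (Euler evaluation). research route conditional on HC_CM; not a corollary; Q11.4-sentence-2 already refuted in dim ≥ 3. [folklore] -/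
theorem trace_xi_sqrtNegOne_five [IsCyclotomicExtension {28} ℚ K] (hζ : IsPrimitiveRoot ζ 28) :
    Algebra.trace ℚ K ((ζ ^ 5 * (aeval ζ (derivative (cyclotomic 28 ℚ)))⁻¹) * (ζ ^ 7) * (ζ + ζ⁻¹) ^ 5) = 20 := by
  have hΦ := cyc_twentyEight hζ
  rw [trace_of_key hζ (C (0 : ℚ) + C (-15 : ℚ) * X + C (0 : ℚ) * X ^ 2 + C (9 : ℚ) * X ^ 3 + C (0 : ℚ) * X ^ 4 +
      C (-10 : ℚ) * X ^ 5 + C (0 : ℚ) * X ^ 6 + C (11 : ℚ) * X ^ 7 + C (0 : ℚ) * X ^ 8 + C (-5 : ℚ) * X ^ 9 +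
      C (0 : ℚ) * X ^ 10 + C (20 : ℚ) * X ^ 11) (by compute_degree) (by
    simp only [map_add, map_mul, map_pow, aeval_C, aeval_X, eq_ratCast]
    push_cast
    linear_combination ((aeval ζ (derivative (cyclotomic 28 ℚ)))⁻¹ * (15 * ζ^6 + 6 * ζ^8 + ζ^10)) * hΦ)]
  norm_num [coeff_X_pow, coeff_X, coeff_C, coeff_one]

/-- `Tr(ζ′sθ^6) = 0` for `ζ′ = ξ = ζ⁵/Φ₂₈′(ζ)`, `s = √−1 = ζ⁷ = i`, `θ = ζ + ζ⁻¹` (Euler evaluation). research route conditional on HC_CM; not a corollary; Q11.4-sentence-2 already refuted in dim ≥ 3. [folklore] -/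
theorem trace_xi_sqrtNegOne_six [IsCyclotomicExtension {28} ℚ K] (hζ : IsPrimitiveRoot ζ 28) :
    Algebra.trace ℚ K ((ζ ^ 5 * (aeval ζ (derivative (cyclotomic 28 ℚ)))⁻¹) * (ζ ^ 7) * (ζ + ζ⁻¹) ^ 6) = 0 := by
  have hΦ := cyc_twentyEight hζ
  rw [trace_of_key hζ (C (-35 : ℚ) + C (0 : ℚ) * X + C (14 : ℚ) * X ^ 2 + C (0 : ℚ) * X ^ 3 + C (-21 : ℚ) * X ^ 4 +
      C (0 : ℚ) * X ^ 5 + C (21 : ℚ) * X ^ 6 + C (0 : ℚ) * X ^ 7 + C (-14 : ℚ) * X ^ 8 + C (0 : ℚ) * X ^ 9 +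
      C (35 : ℚ) * X ^ 10 + C (0 : ℚ) * X ^ 11) (by compute_degree) (by
    simp only [map_add, map_mul, map_pow, aeval_C, aeval_X, eq_ratCast]
    push_cast
    linear_combination ((aeval ζ (derivative (cyclotomic 28 ℚ)))⁻¹ * (35 * ζ^6 + 21 * ζ^8 + 7 * ζ^10 + ζ^12)) * hΦ)]
  norm_num [coeff_X_pow, coeff_X, coeff_C, coeff_one]

/-- `Tr(ζ′sθ^7) = 70` for `ζ′ = ξ = ζ⁵/Φ₂₈′(ζ)`, `s = √−1 = ζ⁷ = i`, `θ = ζ + ζ⁻¹` (Euler evaluation). research route conditional on HC_CM; not a corollary; Q11.4-sentence-2 already refuted in dim ≥ 3. [folklore] -/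
theorem trace_xi_sqrtNegOne_seven [IsCyclotomicExtension {28} ℚ K] (hζ : IsPrimitiveRoot ζ 28) :
    Algebra.trace ℚ K ((ζ ^ 5 * (aeval ζ (derivative (cyclotomic 28 ℚ)))⁻¹) * (ζ ^ 7) * (ζ + ζ⁻¹) ^ 7) = 70 := by
  have hΦ := cyc_twentyEight hζ
  rw [trace_of_key hζ (C (0 : ℚ) + C (-56 : ℚ) * X + C (0 : ℚ) * X ^ 2 + C (28 : ℚ) * X ^ 3 + C (0 : ℚ) * X ^ 4 +
      C (-35 : ℚ) * X ^ 5 + C (0 : ℚ) * X ^ 6 + C (42 : ℚ) * X ^ 7 + C (0 : ℚ) * X ^ 8 + C (-14 : ℚ) * X ^ 9 +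
      C (0 : ℚ) * X ^ 10 + C (70 : ℚ) * X ^ 11) (by compute_degree) (by
    simp only [map_add, map_mul, map_pow, aeval_C, aeval_X, eq_ratCast]
    push_cast
    linear_combination ((aeval ζ (derivative (cyclotomic 28 ℚ)))⁻¹ * (56 * ζ^8 + 28 * ζ^10 + 8 * ζ^12 + ζ^14)) * hΦ)]
  norm_num [coeff_X_pow, coeff_X, coeff_C, coeff_one]

/-- `Tr(ζ′sθ^8) = 0` for `ζ′ = ξ = ζ⁵/Φ₂₈′(ζ)`, `s = √−1 = ζ⁷ = i`, `θ = ζ + ζ⁻¹` (Euler evaluation). research route conditional on HC_CM; not a corollary; Q11.4-sentence-2 already refuted in dim ≥ 3. [folklore] -/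
theorem trace_xi_sqrtNegOne_eight [IsCyclotomicExtension {28} ℚ K] (hζ : IsPrimitiveRoot ζ 28) :
    Algebra.trace ℚ K ((ζ ^ 5 * (aeval ζ (derivative (cyclotomic 28 ℚ)))⁻¹) * (ζ ^ 7) * (ζ + ζ⁻¹) ^ 8) = 0 := by
  have h28 : ζ ^ 28 = 1 := hζ.pow_eq_one
  have hΦ := cyc_twentyEight hζ
  rw [trace_of_key hζ (C (-126 : ℚ) + C (0 : ℚ) * X + C (42 : ℚ) * X ^ 2 + C (0 : ℚ) * X ^ 3 + C (-77 : ℚ) * X ^ 4 +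
      C (0 : ℚ) * X ^ 5 + C (77 : ℚ) * X ^ 6 + C (0 : ℚ) * X ^ 7 + C (-42 : ℚ) * X ^ 8 + C (0 : ℚ) * X ^ 9 +
      C (126 : ℚ) * X ^ 10 + C (0 : ℚ) * X ^ 11) (by compute_degree) (by
    simp only [map_add, map_mul, map_pow, aeval_C, aeval_X, eq_ratCast]
    push_cast
    linear_combination ((aeval ζ (derivative (cyclotomic 28 ℚ)))⁻¹ * (1 + ζ^2 + 126 * ζ^8 + 84 * ζ^10 + 36 * ζ^12 + 8 * ζ^14)) * hΦ +
      ((aeval ζ (derivative (cyclotomic 28 ℚ)))⁻¹ * (1)) * h28)]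
  norm_num [coeff_X_pow, coeff_X, coeff_C, coeff_one]

/-- `Tr(ζ′sθ^9) = 252` for `ζ′ = ξ = ζ⁵/Φ₂₈′(ζ)`, `s = √−1 = ζ⁷ = i`, `θ = ζ + ζ⁻¹` (Euler evaluation). research route conditional on HC_CM; not a corollary; Q11.4-sentence-2 already refuted in dim ≥ 3. [folklore] -/
theorem trace_xi_sqrtNegOne_nine [IsCyclotomicExtension {28} ℚ K] (hζ : IsPrimitiveRoot ζ 28) :
    Algebra.trace ℚ K ((ζ ^ 5 * (aeval ζ (derivative (cyclotomic 28 ℚ)))⁻¹) * (ζ ^ 7) * (ζ + ζ⁻¹) ^ 9) = 252 := by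
  have h28 : ζ ^ 28 = 1 := hζ.pow_eq_one
  have hΦ := cyc_twentyEight hζ
  rw [trace_of_key hζ (C (0 : ℚ) + C (-210 : ℚ) * X + C (0 : ℚ) * X ^ 2 + C (91 : ℚ) * X ^ 3 + C (0 : ℚ) * X ^ 4 +
      C (-126 : ℚ) * X ^ 5 + C (0 : ℚ) * X ^ 6 + C (161 : ℚ) * X ^ 7 + C (0 : ℚ) * X ^ 8 + C (-42 : ℚ) * X ^ 9 +
      C (0 : ℚ) * X ^ 10 + C (252 : ℚ) * X ^ 11) (by compute_degree) (by
    simp only [map_add, map_mul, map_pow, aeval_C, aeval_X, eq_ratCast]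
    push_cast
    linear_combination ((aeval ζ (derivative (cyclotomic 28 ℚ)))⁻¹ * (9 + 10 * ζ^2 + ζ^4 + 210 * ζ^10 + 120 * ζ^12 + 36 * ζ^14)) * hΦ +
      ((aeval ζ (derivative (cyclotomic 28 ℚ)))⁻¹ * (9 + ζ^2)) * h28)]
  norm_num [coeff_X_pow, coeff_X, coeff_C, coeff_one]

/-- `Tr(ζ′sθ^10) = 0` for `ζ′ = ξ = ζ⁵/Φ₂₈′(ζ)`, `s = √−1 = ζ⁷ = i`, `θ = ζ + ζ⁻¹` (Euler evaluation). research route conditional on HC_CM; not a corollary; Q11.4-sentence-2 already refuted in dim ≥ 3. [folklore] -/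
theorem trace_xi_sqrtNegOne_ten [IsCyclotomicExtension {28} ℚ K] (hζ : IsPrimitiveRoot ζ 28) :
    Algebra.trace ℚ K ((ζ ^ 5 * (aeval ζ (derivative (cyclotomic 28 ℚ)))⁻¹) * (ζ ^ 7) * (ζ + ζ⁻¹) ^ 10) = 0 := by
  have h28 : ζ ^ 28 = 1 := hζ.pow_eq_one
  have hΦ := cyc_twentyEight hζ
  rw [trace_of_key hζ (C (-462 : ℚ) + C (0 : ℚ) * X + C (133 : ℚ) * X ^ 2 + C (0 : ℚ) * X ^ 3 + C (-287 : ℚ) * X ^ 4 +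
      C (0 : ℚ) * X ^ 5 + C (287 : ℚ) * X ^ 6 + C (0 : ℚ) * X ^ 7 + C (-133 : ℚ) * X ^ 8 + C (0 : ℚ) * X ^ 9 +
      C (462 : ℚ) * X ^ 10 + C (0 : ℚ) * X ^ 11) (by compute_degree) (by
    simp only [map_add, map_mul, map_pow, aeval_C, aeval_X, eq_ratCast]
    push_cast
    linear_combination ((aeval ζ (derivative (cyclotomic 28 ℚ)))⁻¹ * (45 + 55 * ζ^2 + 11 * ζ^4 + ζ^6 + 462 * ζ^10 + 330 * ζ^12 + 120 * ζ^14)) * hΦ +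
      ((aeval ζ (derivative (cyclotomic 28 ℚ)))⁻¹ * (45 + 10 * ζ^2 + ζ^4)) * h28)]
  norm_num [coeff_X_pow, coeff_X, coeff_C, coeff_one]

/-- **The Gram datum `a` of `(E_ζ′, s)` in the real frame `θ^i` (`i < 6`)** for `ζ′ = ξ = ζ⁵/Φ₂₈′(ζ)` (principal type (1)),
`s = √−1 = ζ⁷ = i`: the integer Hankel matrix `(−Tr(ζ′sθ^{i+j}))ᵢⱼ` (and `b = 0`, part 82 `hb_eq_zero`).
research route conditional on HC_CM; not a corollary; Q11.4-sentence-2 already refuted in dim ≥ 3. [cite: vanGeemen1994HodgeAV, Lemma 5.2 (2)–(3)] -/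
theorem realPart_xi_sqrtNegOne [IsCyclotomicExtension {28} ℚ K] [IsCMField K] (hζ : IsPrimitiveRoot ζ 28)
    {x : Fin 6 → K} (hx : ∀ i, x i = (ζ + ζ⁻¹) ^ (i : ℕ)) {a : Matrix (Fin 6) (Fin 6) ℚ}
    (ha : ∀ i j, a i j = Algebra.trace ℚ K ((ζ ^ 5 * (aeval ζ (derivative (cyclotomic 28 ℚ)))⁻¹) * x i * IsCMField.complexConj K ((ζ ^ 7) * x j))) :
    a = !![0, -2, 0, -6, 0, -20; -2, 0, -6, 0, -20, 0; 0, -6, 0, -20, 0, -70; -6, 0, -20, 0, -70, 0; 0, -20, 0, -70, 0, -252; -20, 0, -70, 0, -252, 0] := by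
  rw [ha_eq (complexConj_sqrtNegOne hζ) (complexConj_thetaFrame hζ hx) ha]
  ext i j
  simp only [Matrix.of_apply, hx, ← pow_add]
  fin_cases i <;> fin_cases j <;> simp [trace_xi_sqrtNegOne_zero hζ, trace_xi_sqrtNegOne_one hζ, trace_xi_sqrtNegOne_two hζ, trace_xi_sqrtNegOne_three hζ, trace_xi_sqrtNegOne_four hζ, trace_xi_sqrtNegOne_five hζ,
    trace_xi_sqrtNegOne_six hζ, trace_xi_sqrtNegOne_seven hζ, trace_xi_sqrtNegOne_eight hζ, trace_xi_sqrtNegOne_nine hζ, trace_xi_sqrtNegOne_ten hζ]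

/-- **`det a = -64`** for `ζ′ = ξ = ζ⁵/Φ₂₈′(ζ)`, `s = √−1 = ζ⁷ = i` (frame `θ^i`, `i < 6`). research route conditional on HC_CM; not a corollary; Q11.4-sentence-2 already refuted in dim ≥ 3. [cite: vanGeemen1994HodgeAV, Lemma 5.2 (3)] -/
theorem det_realPart_xi_sqrtNegOne [IsCyclotomicExtension {28} ℚ K] [IsCMField K] (hζ : IsPrimitiveRoot ζ 28)
    {x : Fin 6 → K} (hx : ∀ i, x i = (ζ + ζ⁻¹) ^ (i : ℕ)) {a : Matrix (Fin 6) (Fin 6) ℚ}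
    (ha : ∀ i j, a i j = Algebra.trace ℚ K ((ζ ^ 5 * (aeval ζ (derivative (cyclotomic 28 ℚ)))⁻¹) * x i * IsCMField.complexConj K ((ζ ^ 7) * x j))) :
    a.det = -64 := by
  rw [realPart_xi_sqrtNegOne hζ hx ha]
  simp [Matrix.det_succ_row_zero, Fin.sum_univ_succ, Fin.succAbove, Matrix.submatrix]
  norm_num

end Summit.HodgeConjecture.Ring2WeilCoverage.WeilGramLevel28

end
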